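import Mathlib.Tactic.Group
import Summits.MatrixMultiplication.MatrixMultiplication.Theses.GelfandPairHosts
import Summits.MatrixMultiplication.MatrixMultiplication.Theorems.GelfandPairHostsKillGlue
import Summits.MatrixMultiplication.MatrixMultiplication.Theorems.GelfandHosting.Negative.AbelianIndex

/-!
# `GelfandHosting` (crux stmt-MatrixMultiplication-7381): general designs with a FREE base set are quotient-form

Negative-side support file of the line lead of line `birth` (2026-08-17); `sorry`-free, no new
definitions.  A module-TPP design `φ : [a]×[b] → G`, `ψ : [b]×[c] → X`, `χ : [a]×[c] → X`
(`φ(i,j) • ψ(j',k) = χ(i',k') ↔ (i,j,k) = (i',j',k')`) is in general MORE than a quotient-form design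
`(F, Hs, P)` (`(f'⁻¹ f h⁻¹ h') • p = p' ⇒ f = f', h = h', p = p'`, sizes `(|F|,|Hs|,|P|)`): writing
`m_{ij} := φ(i,j₀)⁻¹ φ(i,j)`, the element `m_{ij}` maps the base set `P_j = ψ(j,·)` to `P_{j₀} = ψ(j₀,·)`
label by label, so `m_{ij} m_{i'j}⁻¹` lies in the POINTWISE STABILISER of `P_{j₀}`; general designs are
quotient designs twisted by these pointwise stabilisers (route note "GeneralToQuotient").

* `design_transport` — `(φ(i,j₀)⁻¹ φ(i,j)) • ψ(j,k) = ψ(j₀,k)`.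
* `quotientDesign_of_design_free` — if the base set `ψ(j₀,·)` is FREE (its pointwise stabiliser is
  trivial) then `F = φ(·,j₀)`, `Hs = {m_j⁻¹}`, `P = ψ(j₀,·)` is a quotient-form design of the same size
  `(a, b, c)`.  Hence every capacity bound proved for quotient-form designs (the tree's
  `AffineCapacity`, `Negative/AbelianIndex`) applies verbatim to general designs with a free base set:
  a general design can only out-perform quotient designs by using base sets with non-trivial pointwise
  stabilisers (large point stabilisers, small `c`).
* `design_capacity_le_index_sq_of_free` — hence a general design with a free base set has
  `abc ≤ N·[G:B]²` for every abelian subgroup `B`, and (`gelfandHosting_witness_free_index`) a witness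
  of the `∃`-body of the crux `GelfandHosting` at exponent `ε` with a free base set satisfies
  `N³ ≤ (N·[G:B]²)^{2+ε}` for every abelian `B ≤ G` (multiplicity-free ⇒ transitive ⇒ `N ≤ D`).
-/

-- the tree's namespace `Summit.MatrixMultiplication.MatrixMultiplication.…` repeats a component by design
set_option linter.dupNamespace false

namespace Summit.MatrixMultiplication.MatrixMultiplication.Theorems.GelfandHosting.Negative

section Transport

variable {G X : Type*} [Group G] [MulAction G X] {a b c : ℕ}
  (φ : Fin a × Fin b → G) (ψ : Fin b × Fin c → X) (χ : Fin a × Fin c → X)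

/-- **Transport element.** In a module-TPP design, `m_{ij} = φ(i,j₀)⁻¹ φ(i,j)` maps the base set of
column `j` onto that of column `j₀` label by label: `m_{ij} • ψ(j,k) = ψ(j₀,k)`. [folklore] -/
theorem design_transport
    (hdes : ∀ (i i' : Fin a) (j j' : Fin b) (k k' : Fin c),
      φ (i, j) • ψ (j', k) = χ (i', k') ↔ (i = i' ∧ j = j' ∧ k = k'))
    (i : Fin a) (j₀ j : Fin b) (k : Fin c) :
    ((φ (i, j₀))⁻¹ * φ (i, j)) • ψ (j, k) = ψ (j₀, k) := by
  have h1 : φ (i, j) • ψ (j, k) = χ (i, k) := (hdes i i j j k k).mpr ⟨rfl, rfl, rfl⟩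
  have h2 : φ (i, j₀) • ψ (j₀, k) = χ (i, k) := (hdes i i j₀ j₀ k k).mpr ⟨rfl, rfl, rfl⟩
  rw [mul_smul, h1, ← h2, inv_smul_smul]

/-- In a module-TPP design the rows of `φ` at a fixed column are injective (given `c ≥ 1`). [folklore] -/
theorem design_phi_injective
    (hdes : ∀ (i i' : Fin a) (j j' : Fin b) (k k' : Fin c),
      φ (i, j) • ψ (j', k) = χ (i', k') ↔ (i = i' ∧ j = j' ∧ k = k'))
    (j₀ : Fin b) (k₀ : Fin c) : Function.Injective fun i => φ (i, j₀) := by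
  intro i i' h
  have h1 : φ (i, j₀) • ψ (j₀, k₀) = χ (i, k₀) := (hdes i i j₀ j₀ k₀ k₀).mpr ⟨rfl, rfl, rfl⟩
  simp only at h
  rw [h] at h1
  exact ((hdes i' i j₀ j₀ k₀ k₀).mp h1).1.symm

/-- In a module-TPP design each base set `ψ(j₀,·)` is injectively labelled. [folklore] -/
theorem design_psi_injective
    (hdes : ∀ (i i' : Fin a) (j j' : Fin b) (k k' : Fin c),
      φ (i, j) • ψ (j', k) = χ (i', k') ↔ (i = i' ∧ j = j' ∧ k = k'))
    (i₀ : Fin a) (j₀ : Fin b) : Function.Injective fun k => ψ (j₀, k) := by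
  intro k k' h
  have h1 : φ (i₀, j₀) • ψ (j₀, k) = χ (i₀, k) := (hdes i₀ i₀ j₀ j₀ k k).mpr ⟨rfl, rfl, rfl⟩
  simp only at h
  rw [h] at h1
  exact ((hdes i₀ i₀ j₀ j₀ k' k).mp h1).2.2.symm

end Transport

/-- **Free base set ⇒ quotient form.** Let `(φ, ψ, χ)` be a module-TPP design of size `(a,b,c)` with
`a, c ≥ 1` (witnessed by `i₀, k₀`), and suppose the base set `ψ(j₀,·)` of some column is FREE: the only
group element fixing every `ψ(j₀,k)` is `1`.  Then there is a quotient-form design `(F, Hs, P)` of the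
same size: `F = {φ(i,j₀)}`, `Hs = {(φ(i₀,j₀)⁻¹ φ(i₀,j))⁻¹}`, `P = {ψ(j₀,k)}`, with
`(f'⁻¹ f h⁻¹ h') • p = p' ⇒ f = f' ∧ h = h' ∧ p = p'`.  (The transport elements
`φ(i,j₀)⁻¹ φ(i,j)` do not depend on `i` by freeness, which puts `φ(i,j) = f_i h_j⁻¹`.) [folklore] -/
theorem quotientDesign_of_design_free {G X : Type*} [Group G] [MulAction G X] [DecidableEq G]
    [DecidableEq X] {a b c : ℕ} (φ : Fin a × Fin b → G) (ψ : Fin b × Fin c → X)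
    (χ : Fin a × Fin c → X) (i₀ : Fin a) (j₀ : Fin b) (k₀ : Fin c)
    (hdes : ∀ (i i' : Fin a) (j j' : Fin b) (k k' : Fin c),
      φ (i, j) • ψ (j', k) = χ (i', k') ↔ (i = i' ∧ j = j' ∧ k = k'))
    (hfree : ∀ g : G, (∀ k : Fin c, g • ψ (j₀, k) = ψ (j₀, k)) → g = 1) :
    ∃ (F Hs : Finset G) (P : Finset X), F.card = a ∧ Hs.card = b ∧ P.card = c ∧
      ∀ f ∈ F, ∀ f' ∈ F, ∀ h ∈ Hs, ∀ h' ∈ Hs, ∀ p ∈ P, ∀ p' ∈ P,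
        (f'⁻¹ * f * h⁻¹ * h') • p = p' → f = f' ∧ h = h' ∧ p = p' := by
  -- transport elements and their independence of the row
  set m : Fin b → G := fun j => (φ (i₀, j₀))⁻¹ * φ (i₀, j) with hm
  have hmi : ∀ (i : Fin a) (j : Fin b), (φ (i, j₀))⁻¹ * φ (i, j) = m j := by
    intro i j
    have key : ((φ (i, j₀))⁻¹ * φ (i, j) * (m j)⁻¹) = 1 := by
      refine hfree _ fun k => ?_
      have t1 := design_transport φ ψ χ hdes i j₀ j k
      have t2 := design_transport φ ψ χ hdes i₀ j₀ j k
      -- `(m j)⁻¹ • ψ(j₀,k) = ψ(j,k)`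
      have t3 : (m j)⁻¹ • ψ (j₀, k) = ψ (j, k) := by
        rw [← t2, inv_smul_smul]
      rw [mul_smul, t3, t1]
    calc (φ (i, j₀))⁻¹ * φ (i, j) = ((φ (i, j₀))⁻¹ * φ (i, j) * (m j)⁻¹) * m j := by group
      _ = m j := by rw [key, one_mul]
  -- hence `φ(i,j) = f_i * m_j` and `ψ(j,k) = (m j)⁻¹ • p_k`
  have hphi : ∀ (i : Fin a) (j : Fin b), φ (i, j) = φ (i, j₀) * m j := by
    intro i j; rw [← hmi i j]; group
  have hpsi : ∀ (j : Fin b) (k : Fin c), ψ (j, k) = (m j)⁻¹ • ψ (j₀, k) := by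
    intro j k
    rw [← design_transport φ ψ χ hdes i₀ j₀ j k, inv_smul_smul]
  have hm0 : m j₀ = 1 := by rw [hm]; group
  -- the three finsets
  let fF : Fin a → G := fun i => φ (i, j₀)
  let fH : Fin b → G := fun j => (m j)⁻¹
  let fP : Fin c → X := fun k => ψ (j₀, k)
  have hFinj : Function.Injective fF := design_phi_injective φ ψ χ hdes j₀ k₀
  have hPinj : Function.Injective fP := design_psi_injective φ ψ χ hdes i₀ j₀
  have hHinj : Function.Injective fH := by
    intro j j' h
    have e1 := hpsi j k₀
    have e2 := hpsi j' k₀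
    simp only [fH] at h
    rw [h, ← e2] at e1
    -- `ψ(j,k₀) = ψ(j',k₀)` forces `j = j'`
    have t : φ (i₀, j) • ψ (j, k₀) = χ (i₀, k₀) := (hdes i₀ i₀ j j k₀ k₀).mpr ⟨rfl, rfl, rfl⟩
    rw [e1] at t
    exact ((hdes i₀ i₀ j j' k₀ k₀).mp t).2.1
  refine ⟨Finset.univ.image fF, Finset.univ.image fH, Finset.univ.image fP,
    by rw [Finset.card_image_of_injective _ hFinj]; simp,
    by rw [Finset.card_image_of_injective _ hHinj]; simp,
    by rw [Finset.card_image_of_injective _ hPinj]; simp, ?_⟩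
  intro f hf f' hf' h hh h' hh' p hp p' hp' heq
  simp only [Finset.mem_image, Finset.mem_univ, true_and] at hf hf' hh hh' hp hp'
  obtain ⟨i, rfl⟩ := hf
  obtain ⟨i', rfl⟩ := hf'
  obtain ⟨j, rfl⟩ := hh
  obtain ⟨j', rfl⟩ := hh'
  obtain ⟨k, rfl⟩ := hp
  obtain ⟨k', rfl⟩ := hp'
  simp only [fF, fH, fP, inv_inv] at heq ⊢
  -- `heq : ((φ(i',j₀))⁻¹ * φ(i,j₀) * m j * (m j')⁻¹) • ψ(j₀,k) = ψ(j₀,k')`, i.e. `φ(i,j) • ψ(j',k) = χ(i',k')`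
  have key : φ (i, j) • ψ (j', k) = χ (i', k') := by
    have e3 : φ (i', j₀) • ψ (j₀, k') = χ (i', k') := (hdes i' i' j₀ j₀ k' k').mpr ⟨rfl, rfl, rfl⟩
    rw [hphi i j, hpsi j' k, ← e3, ← heq]
    simp only [← mul_smul]
    congr 1
    group
  obtain ⟨r1, r2, r3⟩ := (hdes i i' j j' k k').mp key
  subst r1 r2 r3
  exact ⟨rfl, rfl, rfl⟩

/-! ## Consequences: capacity and witness shape for designs with a free base set -/

/-- **Abelian-index bound for general designs with a free base set.** If a module-TPP design of size
`(a,b,c)` (`a, c ≥ 1`) has a free base set `ψ(j₀,·)`, then `abc ≤ |X|·[G:B]²` for every abelian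
subgroup `B ≤ G` (combine `quotientDesign_of_design_free` with
`quotientDesign_capacity_le_index_sq`). [folklore] -/
theorem design_capacity_le_index_sq_of_free {G : Type} [Group G] [Fintype G] {X : Type} [Fintype X]
    [DecidableEq X] [MulAction G X] {a b c : ℕ} (φ : Fin a × Fin b → G) (ψ : Fin b × Fin c → X)
    (χ : Fin a × Fin c → X) (i₀ : Fin a) (j₀ : Fin b) (k₀ : Fin c)
    (hdes : ∀ (i i' : Fin a) (j j' : Fin b) (k k' : Fin c),
      φ (i, j) • ψ (j', k) = χ (i', k') ↔ (i = i' ∧ j = j' ∧ k = k'))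
    (hfree : ∀ g : G, (∀ k : Fin c, g • ψ (j₀, k) = ψ (j₀, k)) → g = 1)
    (B : Subgroup G) (hcomm : ∀ x ∈ B, ∀ y ∈ B, x * y = y * x) :
    a * b * c ≤ Fintype.card X * B.index ^ 2 := by
  classical
  obtain ⟨F, Hs, P, hF, hH, hP, hq⟩ := quotientDesign_of_design_free φ ψ χ i₀ j₀ k₀ hdes hfree
  have h := quotientDesign_capacity_le_index_sq B F Hs P hcomm hq
  rwa [hF, hH, hP] at h

/-- **Witness shape for the crux (free base set case).** Let `(G ↷ X, φ, ψ, χ)` satisfy the `∃`-body of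
`GelfandHosting` at exponent `ε` — multiplicity-free host, module-TPP design of size `(a,b,c)` with
`a, c ≥ 1`, and `D = dim span{P_g} ≤ (abc)^{(2+ε)/3}` — and suppose some base set `ψ(j₀,·)` is free.
Then `N³ ≤ (N·[G:B]²)^{2+ε}` for every abelian subgroup `B ≤ G` (`N = |X|`), i.e. every abelian
subgroup has index at least `N^{(1-ε)/(8+4ε)}`: multiplicity-free ⇒ transitive
(`killGlue_transitive_of_comm`) ⇒ `N ≤ D` (`killGlue_card_le_finrank`) `≤ (abc)^{(2+ε)/3} ≤ (N[G:B]²)^{(2+ε)/3}`.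
[folklore] -/
theorem gelfandHosting_witness_free_index {G : Type} [Group G] [Fintype G] {X : Type} [Fintype X]
    [DecidableEq X] [MulAction G X] {a b c : ℕ} (φ : Fin a × Fin b → G) (ψ : Fin b × Fin c → X)
    (χ : Fin a × Fin c → X) (i₀ : Fin a) (j₀ : Fin b) (k₀ : Fin c) (ε : ℝ) (hε : 0 < ε)
    (hmf : ∀ A A' : Matrix X X ℂ, (∀ (g : G) (x y : X), A (g • x) (g • y) = A x y) →
      (∀ (g : G) (x y : X), A' (g • x) (g • y) = A' x y) → A * A' = A' * A)
    (hdes : ∀ (i i' : Fin a) (j j' : Fin b) (k k' : Fin c),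
      φ (i, j) • ψ (j', k) = χ (i', k') ↔ (i = i' ∧ j = j' ∧ k = k'))
    (hD : (Module.finrank ℂ (Submodule.span ℂ (Set.range fun g : G =>
        Matrix.of fun y x : X => if g • x = y then (1 : ℂ) else 0)) : ℝ) ≤
      ((a * b * c : ℕ) : ℝ) ^ ((2 + ε) / 3))
    (hfree : ∀ g : G, (∀ k : Fin c, g • ψ (j₀, k) = ψ (j₀, k)) → g = 1)
    (B : Subgroup G) (hcomm : ∀ x ∈ B, ∀ y ∈ B, x * y = y * x) :
    (Fintype.card X : ℝ) ^ (3 : ℝ) ≤ ((Fintype.card X * B.index ^ 2 : ℕ) : ℝ) ^ (2 + ε) := by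
  have htrans : ∀ x y : X, ∃ g : G, g • x = y :=
    Summit.MatrixMultiplication.MatrixMultiplication.Theorems.killGlue_transitive_of_comm hmf
  have hN : (Fintype.card X : ℝ) ≤ (Module.finrank ℂ (Submodule.span ℂ (Set.range fun g : G =>
      Matrix.of fun y x : X => if g • x = y then (1 : ℂ) else 0)) : ℝ) := by
    exact_mod_cast Summit.MatrixMultiplication.MatrixMultiplication.Theorems.killGlue_card_le_finrank
      (ψ (j₀, k₀)) htrans
  have hcap : ((a * b * c : ℕ) : ℝ) ≤ ((Fintype.card X * B.index ^ 2 : ℕ) : ℝ) := by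
    exact_mod_cast design_capacity_le_index_sq_of_free φ ψ χ i₀ j₀ k₀ hdes hfree B hcomm
  have hexp : 0 ≤ (2 + ε) / 3 := by positivity
  have h1 : (Fintype.card X : ℝ) ≤ ((Fintype.card X * B.index ^ 2 : ℕ) : ℝ) ^ ((2 + ε) / 3) :=
    hN.trans (hD.trans (Real.rpow_le_rpow (by positivity) hcap hexp))
  have h2 := Real.rpow_le_rpow (by positivity) h1 (show (0 : ℝ) ≤ 3 by norm_num)
  rw [← Real.rpow_mul (by positivity)] at h2
  have e : (2 + ε) / 3 * 3 = 2 + ε := by ring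
  rwa [e] at h2

end Summit.MatrixMultiplication.MatrixMultiplication.Theorems.GelfandHosting.Negative
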